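/-
Copyright (c) 2026 the pub-hodgecm-mathlib formalisation cell (harness21).  Prover seat hodgecm-mathlib-K2E3-p14 (g2), Track B «K2-LIT» ∕ h413
(`stmt-HodgeConjecture-24833`), unit U12 «Harish-Chandra characters» of the line `K2_E3_EllipticInputs`, socket U12-h ‹#9L› `sig_K2E3CharLocConstNearRegular`:
brick (Fr) of the 9L depth-halving road (K2E3-p09 (g2) MEMO v4 §2), addendum: the FILTRATION PACK in the binder shapes of ★ p855781 `depthHalving`.  2026-09-03.
-/
import Summits.HodgeConjecture.HodgeConjecture.Theorems.K2E3UnitaryCongruenceFrame   -- ★ p855784 (this seat): transport of the levels along `e : G ≃ₜ* U`; brings ★ p855729 part 1, ★ `GLnCongruenceCommutators` (`commutator_mem_comap_congruenceGL`, `conj_mem_comap_congruenceGL`)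
import HarnessLib

/-!
# Crux `H413` — K2-LIT E3 «EllipticInputs», U12-h brick (Fr), addendum: THE CONGRUENCE FILTRATION `Kf m := e⁻¹(U ∩ K_{|ϖ|^m})` IN THE BINDER SHAPES OF ★ `depthHalving`
# (p855781): `hanti`, `hcommf`, `hnormf` (with `K₁ = Kf ν`, or any `K₁` inside the integral level), `hKfle`, the triviality depth `hM` from an open `K′`, and the
# `K₁`-side facts `1 ∈ Kf m`, `Kf m` compact open

Cell `hodgecm-mathlib`, Track B «K2-LIT», crux item `stmt-HodgeConjecture-24833` (h413), line `K2_E3_EllipticInputs`, unit U12 «HC characters», socket U12-h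
`sig_K2E3CharLocConstNearRegular` (‹#9L›).  The 9L line lead's endgame ★ p855781 `K2E3DepthHalvingEndgame.depthHalving` (K2E3-p09 (g2)) takes its congruence filtration as
`(Kf : ℕ → Subgroup G) (hanti : ∀ m m', m ≤ m' → Kf m' ≤ Kf m) (hcommf : ∀ m m', ∀ a ∈ Kf m, ∀ b ∈ Kf m', a * b * a⁻¹ * b⁻¹ ∈ Kf (m + m'))
(hnormf : ∀ m, ∀ x ∈ K₁, ∀ a ∈ Kf m, x * a * x⁻¹ ∈ Kf m) (ν : ℕ) (hKfle : ∀ m, ν ≤ m → Kf m ≤ K₁) (M : ℕ) (hM : ∀ a ∈ Kf M, … trivial on c)`; the (Glue) file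
`K2E3HoweFinitenessOfBricks` instantiates it at the frame `Kf m := (congruenceGL n (valuation F ϖ ^ m)).comap (U.subtype.comp e)` of ★ p855784 (`e : G ≃ₜ* U` the
one-place model, `U ≤ GL_n(F)`).  THIS FILE states exactly those five binders for that `Kf` (ELEMENT forms; the subgroup forms are ★ p855784
`comap_congruenceGL_pow_le_of_le` ∕ `commutator_comap_congruenceGL_pow_le` ∕ `map_conj_comap_congruenceGL` and ★ `GLnCongruenceCommutators` §4), so the instantiation is by
`exact`.  `--supports stmt-HodgeConjecture-24833 --as helper`.  THEOREMS ONLY — no `def`, no named fact, no instance, no notation, no `sorry`.  HONEST LABEL: HC_CM is proved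
only modulo the 7 printed citations (2 remaining named inputs: hLiu418 = stmt-HodgeConjecture-24832, h413 = stmt-HodgeConjecture-24833) until rung 0 closes; count-neutral
plumbing.

* `frame_hanti` — `m ≤ m' → Kf m' ≤ Kf m`;  `frame_hcommf` — `a ∈ Kf m, b ∈ Kf m' ⇒ a b a⁻¹ b⁻¹ ∈ Kf (m + m')` (★ `commutator_mem_comap_congruenceGL`, `|ϖ|^m |ϖ|^{m'} = |ϖ|^{m+m'}`);
  `frame_hnormf_of_le_integral` — for ANY `K₁` inside the integral level `e⁻¹(U ∩ GL_n(𝒪))`, `x ∈ K₁, a ∈ Kf m ⇒ x a x⁻¹ ∈ Kf m` (★ `conj_mem_comap_congruenceGL_of_mem_comap_glInt`),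
  and `frame_hnormf` — the case `K₁ = Kf ν`;  `frame_hKfle` — `ν ≤ m → Kf m ≤ Kf ν`;  `frame_hM` — an open subgroup `K′` (e.g. one acting trivially on the type `c`) contains
  some `Kf M`, in the element form `∀ a ∈ Kf M, a ∈ K′`;  `frame_pack` — the four filtration clauses in ONE conjunction for a one-line `obtain`.

## References
* [HarishChandra1999] Harish-Chandra (DeBacker–Sally), *Admissible Invariant Distributions on Reductive p-adic Groups*, ULECT 16 (1999), §17 p. 80 (the filtration
  `K_m = exp ϖ^m L`), §19 pp. 84–86.
* [Casselman1995] W. Casselman, *Introduction to the theory of admissible representations of p-adic reductive groups* (1995), §1.4 Prop. 1.4.4 (`⁅K_m, K_{m'}⁆ ≤ K_{m+m'}`).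
* [BernsteinZelevinsky1976] I. N. Bernstein, A. V. Zelevinsky, Russian Math. Surveys 31:3 (1976), §1.1, §3.
-/

set_option autoImplicit false
-- the mandated namespace repeats `HodgeConjecture.HodgeConjecture`, as in every `Theorems/*.lean` of this sub-problem
set_option linter.dupNamespace false

noncomputable section

open Topology Filter Set ValuativeRel Matrix
open Literature.NumberTheory.Automorphic
open Summit.HodgeConjecture.HodgeConjecture.Cruxes.H413 Summit.HodgeConjecture.HodgeConjecture.Cruxes.H413.K2E3UnitaryCongruenceFrame
open scoped MatrixGroups Pointwise

namespace Summit.HodgeConjecture.HodgeConjecture.Cruxes.H413.K2E3UnitaryCongruenceFiltration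

section Algebra

variable {F : Type*} [Field F] [ValuativeRel F] [TopologicalSpace F] {n : ℕ} {U : Subgroup (GL (Fin n) F)}
  {G : Type*} [Group G] [TopologicalSpace G] (e : G ≃ₜ* U) {ϖ : F}

/-- **`hanti`**: `m ≤ m' → Kf m' ≤ Kf m` for `Kf m = e⁻¹(U ∩ K_{|ϖ|^m})` (★ p855784 `comap_congruenceGL_pow_le_of_le`, restated in `depthHalving`'s binder order).
[cite: HarishChandra1999, §17 p. 80] -/
theorem frame_hanti (hϖ : IsUniformizingElement ϖ) :
    ∀ m m' : ℕ, m ≤ m' →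
      (congruenceGL n (valuation F ϖ ^ m')).comap (U.subtype.comp e.toMulEquiv.toMonoidHom) ≤
        (congruenceGL n (valuation F ϖ ^ m)).comap (U.subtype.comp e.toMulEquiv.toMonoidHom) :=
  fun _ _ h => comap_congruenceGL_pow_le_of_le e hϖ h

/-- **`hcommf`** (element form): `a ∈ Kf m`, `b ∈ Kf m'` ⇒ `a b a⁻¹ b⁻¹ ∈ Kf (m + m')` (★ `commutator_mem_comap_congruenceGL` along `f = U.subtype.comp e`,
`|ϖ|^m · |ϖ|^{m'} = |ϖ|^{m+m'}`). [cite: Casselman1995, §1.4 Prop. 1.4.4] [cite: BernsteinZelevinsky1976, §3] -/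
theorem frame_hcommf (ϖ : F) :
    ∀ m m' : ℕ, ∀ a ∈ (congruenceGL n (valuation F ϖ ^ m)).comap (U.subtype.comp e.toMulEquiv.toMonoidHom),
      ∀ b ∈ (congruenceGL n (valuation F ϖ ^ m')).comap (U.subtype.comp e.toMulEquiv.toMonoidHom),
        a * b * a⁻¹ * b⁻¹ ∈ (congruenceGL n (valuation F ϖ ^ (m + m'))).comap (U.subtype.comp e.toMulEquiv.toMonoidHom) := by
  intro m m' a ha b hb
  rw [pow_add]
  exact commutator_mem_comap_congruenceGL _ ha hb

/-- **`hnormf` for ANY `K₁` INSIDE THE INTEGRAL LEVEL** `e⁻¹(U ∩ GL_n(𝒪))`: `x ∈ K₁`, `a ∈ Kf m` ⇒ `x a x⁻¹ ∈ Kf m` (★ `conj_mem_comap_congruenceGL_of_mem_comap_glInt`).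
[cite: Casselman1995, §1.4 Prop. 1.4.4] -/
theorem frame_hnormf_of_le_integral {K₁ : Subgroup G} (hK₁ : K₁ ≤ (glInt n F).comap (U.subtype.comp e.toMulEquiv.toMonoidHom)) (ϖ : F) :
    ∀ m : ℕ, ∀ x ∈ K₁, ∀ a ∈ (congruenceGL n (valuation F ϖ ^ m)).comap (U.subtype.comp e.toMulEquiv.toMonoidHom),
      x * a * x⁻¹ ∈ (congruenceGL n (valuation F ϖ ^ m)).comap (U.subtype.comp e.toMulEquiv.toMonoidHom) :=
  fun _ _ hx _ ha => conj_mem_comap_congruenceGL_of_mem_comap_glInt _ (hK₁ hx) ha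

/-- **`hnormf` with `K₁ = Kf ν`**: `x ∈ Kf ν`, `a ∈ Kf m` ⇒ `x a x⁻¹ ∈ Kf m` (★ `conj_mem_comap_congruenceGL`; any `ν`, `m`). [cite: Casselman1995, §1.4 Prop. 1.4.4] -/
theorem frame_hnormf (ϖ : F) (ν : ℕ) :
    ∀ m : ℕ, ∀ x ∈ (congruenceGL n (valuation F ϖ ^ ν)).comap (U.subtype.comp e.toMulEquiv.toMonoidHom),
      ∀ a ∈ (congruenceGL n (valuation F ϖ ^ m)).comap (U.subtype.comp e.toMulEquiv.toMonoidHom),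
        x * a * x⁻¹ ∈ (congruenceGL n (valuation F ϖ ^ m)).comap (U.subtype.comp e.toMulEquiv.toMonoidHom) :=
  fun _ _ hx _ ha => conj_mem_comap_congruenceGL _ hx ha

/-- **`hKfle`**: `ν ≤ m → Kf m ≤ Kf ν` (= `hanti` at `(ν, m)`). [cite: HarishChandra1999, §17 p. 80] -/
theorem frame_hKfle (hϖ : IsUniformizingElement ϖ) (ν : ℕ) :
    ∀ m : ℕ, ν ≤ m →
      (congruenceGL n (valuation F ϖ ^ m)).comap (U.subtype.comp e.toMulEquiv.toMonoidHom) ≤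
        (congruenceGL n (valuation F ϖ ^ ν)).comap (U.subtype.comp e.toMulEquiv.toMonoidHom) :=
  fun _ h => comap_congruenceGL_pow_le_of_le e hϖ h

/-- **THE FILTRATION PACK** — `hanti ∧ hcommf ∧ hnormf ∧ hKfle` for `Kf m = e⁻¹(U ∩ K_{|ϖ|^m})` and `K₁ = Kf ν`, for a one-line `obtain ⟨hanti, hcommf, hnormf, hKfle⟩`.
[cite: HarishChandra1999, §17 p. 80] [cite: Casselman1995, §1.4 Prop. 1.4.4] -/
theorem frame_pack (hϖ : IsUniformizingElement ϖ) (ν : ℕ) :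
    (∀ m m' : ℕ, m ≤ m' →
      (congruenceGL n (valuation F ϖ ^ m')).comap (U.subtype.comp e.toMulEquiv.toMonoidHom) ≤
        (congruenceGL n (valuation F ϖ ^ m)).comap (U.subtype.comp e.toMulEquiv.toMonoidHom)) ∧
    (∀ m m' : ℕ, ∀ a ∈ (congruenceGL n (valuation F ϖ ^ m)).comap (U.subtype.comp e.toMulEquiv.toMonoidHom),
      ∀ b ∈ (congruenceGL n (valuation F ϖ ^ m')).comap (U.subtype.comp e.toMulEquiv.toMonoidHom),
        a * b * a⁻¹ * b⁻¹ ∈ (congruenceGL n (valuation F ϖ ^ (m + m'))).comap (U.subtype.comp e.toMulEquiv.toMonoidHom)) ∧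
    (∀ m : ℕ, ∀ x ∈ (congruenceGL n (valuation F ϖ ^ ν)).comap (U.subtype.comp e.toMulEquiv.toMonoidHom),
      ∀ a ∈ (congruenceGL n (valuation F ϖ ^ m)).comap (U.subtype.comp e.toMulEquiv.toMonoidHom),
        x * a * x⁻¹ ∈ (congruenceGL n (valuation F ϖ ^ m)).comap (U.subtype.comp e.toMulEquiv.toMonoidHom)) ∧
    (∀ m : ℕ, ν ≤ m →
      (congruenceGL n (valuation F ϖ ^ m)).comap (U.subtype.comp e.toMulEquiv.toMonoidHom) ≤
        (congruenceGL n (valuation F ϖ ^ ν)).comap (U.subtype.comp e.toMulEquiv.toMonoidHom)) :=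
  ⟨frame_hanti e hϖ, frame_hcommf e ϖ, frame_hnormf e ϖ ν, frame_hKfle e hϖ ν⟩

/-- `1 ∈ Kf m` and `Kf m` is a subgroup — trivial, recorded for the slice set's `1 ∈ K₁` binder (★ p855784 `forall_mul_mem_conjSlice_mul_of_one_mem`). [cite: BernsteinZelevinsky1976, §3] -/
theorem one_mem_frame (ϖ : F) (m : ℕ) :
    (1 : G) ∈ (congruenceGL n (valuation F ϖ ^ m)).comap (U.subtype.comp e.toMulEquiv.toMonoidHom) :=
  Subgroup.one_mem _

/-- Every `Kf m` lies in the integral level `e⁻¹(U ∩ GL_n(𝒪))` (the `hK₁`∕`hK₀` binders of ★ p855784 `exists_height_conjSlice_mul`). [cite: BernsteinZelevinsky1976, §3] -/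
theorem frame_le_integral (ϖ : F) (m : ℕ) :
    (congruenceGL n (valuation F ϖ ^ m)).comap (U.subtype.comp e.toMulEquiv.toMonoidHom) ≤ (glInt n F).comap (U.subtype.comp e.toMulEquiv.toMonoidHom) :=
  Subgroup.comap_mono (congruenceGL_le_glInt _)

/-- The `hnK₀` binder of ★ p855602 at the frame: `∀ x ∈ Kf ν, (Kf m).map (MulAut.conj x).toMonoidHom = Kf m` (★ p855784 `forall_map_conj_comap_congruenceGL_of_mem`).
[cite: BernsteinZelevinsky1976, §3] -/
theorem frame_hnK (ϖ : F) (ν m : ℕ) :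
    ∀ x ∈ (congruenceGL n (valuation F ϖ ^ ν)).comap (U.subtype.comp e.toMulEquiv.toMonoidHom),
      ((congruenceGL n (valuation F ϖ ^ m)).comap (U.subtype.comp e.toMulEquiv.toMonoidHom)).map (MulAut.conj x).toMonoidHom =
        (congruenceGL n (valuation F ϖ ^ m)).comap (U.subtype.comp e.toMulEquiv.toMonoidHom) :=
  forall_map_conj_comap_congruenceGL_of_mem e _ _

end Algebra

section Topology

variable {F : Type*} [Field F] [ValuativeRel F] [TopologicalSpace F] [IsNonarchimedeanLocalField F] {n : ℕ} {U : Subgroup (GL (Fin n) F)}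
  {G : Type*} [Group G] [TopologicalSpace G] (e : G ≃ₜ* U) {ϖ : F}

/-- **`hM` FROM AN OPEN SUBGROUP**: every open subgroup `K′ ≤ G` (e.g. a level acting trivially on the type `c`) contains some `Kf M`, in the element form
`∀ a ∈ Kf M, a ∈ K′` (★ p855784 `exists_comap_congruenceGL_pow_le`). [cite: BernsteinZelevinsky1976, §1.1] -/
theorem frame_hM (hϖ0 : ϖ ≠ 0) (hϖ1 : valuation F ϖ < 1) {K' : Subgroup G} (hK' : IsOpen (K' : Set G)) :
    ∃ M : ℕ, ∀ a ∈ (congruenceGL n (valuation F ϖ ^ M)).comap (U.subtype.comp e.toMulEquiv.toMonoidHom), a ∈ K' := by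
  obtain ⟨M, hM⟩ := exists_comap_congruenceGL_pow_le e hϖ0 hϖ1 hK'
  exact ⟨M, fun a ha => hM ha⟩

/-- **THE TRIVIALITY DEPTH OF A TYPE**: if `K′` is an open subgroup and the operators `L a`, `a ∈ K′`, fix a set `c` of vectors pointwise, then some `Kf M` does — the `hM` binder
of ★ `depthHalving` verbatim (`∀ a ∈ Kf M, ∀ w, w ∈ c → L a w = w`), for any family `L` and any predicate in place of `τ.asModuleEquiv.symm w ∈ c`.
[cite: HarishChandra1999, §19 pp. 84–86] [cite: BernsteinZelevinsky1976, §1.1] -/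
theorem frame_hM_of_forall (hϖ0 : ϖ ≠ 0) (hϖ1 : valuation F ϖ < 1) {K' : Subgroup G} (hK' : IsOpen (K' : Set G)) {W : Type*} (L : G → W → W)
    (P : W → Prop) (hfix : ∀ a ∈ K', ∀ w : W, P w → L a w = w) :
    ∃ M : ℕ, ∀ a ∈ (congruenceGL n (valuation F ϖ ^ M)).comap (U.subtype.comp e.toMulEquiv.toMonoidHom), ∀ w : W, P w → L a w = w := by
  obtain ⟨M, hM⟩ := frame_hM e hϖ0 hϖ1 hK'
  exact ⟨M, fun a ha w hw => hfix a (hM a ha) w hw⟩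

/-- `Kf m` is compact open for `m : ℕ` (`U` closed; `|ϖ|^m ≠ 0`) — the `hK₀o`∕`hK₀c`∕`hK₁o`∕`hK₁c` binders of ★ p855602 at `K₀ = Kf N₀`, `K₁ = Kf ν`.
[cite: BernsteinZelevinsky1976, §1.1] [cite: HarishChandra1999, §19 p. 84] -/
theorem isOpen_isCompact_frame (hU : IsClosed (U : Set (GL (Fin n) F))) (hϖ0 : ϖ ≠ 0) (m : ℕ) :
    IsOpen (((congruenceGL n (valuation F ϖ ^ m)).comap (U.subtype.comp e.toMulEquiv.toMonoidHom) : Subgroup G) : Set G) ∧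
      IsCompact (((congruenceGL n (valuation F ϖ ^ m)).comap (U.subtype.comp e.toMulEquiv.toMonoidHom) : Subgroup G) : Set G) :=
  ⟨isOpen_comap_congruenceGL e (pow_ne_zero _ ((Valuation.ne_zero_iff _).2 hϖ0)), isCompact_comap_congruenceGL e hU _⟩

end Topology

end Summit.HodgeConjecture.HodgeConjecture.Cruxes.H413.K2E3UnitaryCongruenceFiltration

end
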